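import Summits.AtomisticToContinuum.Crystallization.Theorems.FreeSplittingCertificatesStrictSplittingRuleDefs
import Literature.MathematicalPhysics.StatisticalMechanics.PeriodicConfigurationSums
import Literature.MathematicalPhysics.StatisticalMechanics.CrystallizationLocalLimit

/-!
# `StrictSplittingRule` (stmt-AtomisticToContinuum-12560) · Negative I: no centrosymmetric shell is close to `S(a,t)`; lattice balls

Part 1 of the NECESSARY CONDITION carried by the crux (lead of line `birth`): the stretched hcp shell
`S(a,t) = target a t` (twelve points, the anticuboctahedron stretched by `1+t` along its hexagonal axis,
`|t| ≤ 1/100`) is NOT centrosymmetric, quantitatively: the CAP point `u₀ = (3,3,0)/√18` of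
`hcpKissingPattern` has `|u₀ + u'|² ≥ 1/3` for every pattern point `u'` (integer arithmetic on the model
`hcpInt`: all twelve sums have squared norm `≥ 6 = 18/3`; the six hexagonal-layer points do come in
antipodal pairs), hence `|S(u₀) + S(u')| > 2a/5` for the stretched-and-scaled points; so no finite point
set `T` with `T = −T` is `(a/5)`-close (`ShellCloseTo`, up to any linear isometry) to `S(a,t)` — matching
`p ↦ A S(u₀)` and `−p ↦ A S(u')` would give `|S(u₀) + S(u')| ≤ 2a/5`.  Every site of a Bravais
lattice has a centrosymmetric first shell, which is how the crux forces a uniform energy gap above `e_∞`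
on all Bravais lattices (sibling file `…FalseOfBravaisGroundState.lean`, `bravaisGap_of_strictSplittingRule`).
Parts 2–3 here: the points of a Bravais configuration (`y + G`), reflections and lattice translations, and
for an injective enumeration `x` of the points in a ball about `y = x i₀` the PATTERN IDENTITY — the joint
`R`-pattern of the reflected bond `(i₀, σ j)` is the pattern of `(i₀, j)` recentred by `−(x j − y)` whenever
`dist (x j) y ≤ ρ − R` — whence the two weights of ANY rule (box + complementarity) on a bond and on its
reflection sum to one (`bravaisGap_weight_add_weight_refl`).  No definitions; all [folklore] bookkeeping.
-/

noncomputable section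

namespace Summit.AtomisticToContinuum.Crystallization.Theorems.StrictSplittingRuleBirth

open scoped BigOperators Classical
open Literature.MathematicalPhysics.StatisticalMechanics
open Literature.Geometry.DiscreteGeometry

/-- Euclidean `3`-space. -/
local notation "E3" => EuclideanSpace ℝ (Fin 3)

/-! ## Integer arithmetic on the model `hcpInt` -/

/-- The CAP vector `(3,3,0)` of the integer model of the hcp pattern has no near-antipode in the
pattern: every sum `(3,3,0) + w`, `w ∈ hcpInt`, has squared norm `≥ 6` (the closest are the lower-cap
vectors, `(3,3,0) + (−1,−4,−1) = (2,−1,−1)`).  (The six hexagonal-layer vectors DO come in antipodal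
pairs; the caps are what makes the anticuboctahedron non-centrosymmetric.) -/
theorem bravaisGap_six_le_sqNormInt_cap_add :
    ∀ w ∈ hcpInt, (6 : ℤ) ≤ sqNormInt (![3, 3, 0] + w) := by
  decide

/-- The cap vector belongs to the model. -/
theorem bravaisGap_cap_mem_hcpInt : (![3, 3, 0] : Fin 3 → ℤ) ∈ hcpInt := by
  decide

/-- The cap point `u₀ = (3,3,0)/√18` of `hcpKissingPattern`. -/
theorem bravaisGap_cap_mem :
    ((Real.sqrt (18 : ℕ))⁻¹ • intVec ![3, 3, 0] : E3) ∈ hcpKissingPattern :=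
  Finset.mem_image_of_mem _ bravaisGap_cap_mem_hcpInt

/-- `intVec` is additive. -/
theorem bravaisGap_intVec_add (v w : Fin 3 → ℤ) : intVec v + intVec w = intVec (v + w) := by
  ext i; simp [intVec]

/-- The squared norm of an integer vector is its integer squared norm. -/
theorem bravaisGap_norm_intVec_sq (v : Fin 3 → ℤ) : ‖intVec v‖ ^ 2 = (sqNormInt v : ℝ) := by
  rw [EuclideanSpace.real_norm_sq_eq, Fin.sum_univ_three]
  simp only [intVec_apply, sqNormInt]
  push_cast
  ring

/-- **The cap point has no near-antipode in the hcp pattern**: `‖u₀ + u'‖² ≥ 1/3` for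
`u' ∈ hcpKissingPattern`, `u₀ = (3,3,0)/√18`. -/
theorem bravaisGap_third_le_norm_cap_add_sq {u' : E3} (hu' : u' ∈ hcpKissingPattern) :
    1 / 3 ≤ ‖((Real.sqrt (18 : ℕ))⁻¹ • intVec ![3, 3, 0] : E3) + u'‖ ^ 2 := by
  simp only [hcpKissingPattern, scaledPattern, Finset.mem_image] at hu'
  obtain ⟨w, hw, rfl⟩ := hu'
  have hcast : ((18 : ℕ) : ℝ) = 18 := by norm_num
  have h18 : (0 : ℝ) < Real.sqrt 18 := by positivity
  rw [hcast, ← smul_add, bravaisGap_intVec_add, norm_smul, norm_inv, Real.norm_of_nonneg h18.le, mul_pow,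
    bravaisGap_norm_intVec_sq, inv_pow, Real.sq_sqrt (by norm_num : (0:ℝ) ≤ 18)]
  have h6 : (6 : ℝ) ≤ (sqNormInt (![3, 3, 0] + w) : ℝ) := by
    exact_mod_cast bravaisGap_six_le_sqNormInt_cap_add w hw
  rw [le_inv_mul_iff₀ (by norm_num : (0:ℝ) < 18)]
  linarith

/-- Hence `‖u₀ + u'‖ ≥ 1/2` for `u' ∈ hcpKissingPattern`. -/
theorem bravaisGap_half_le_norm_cap_add {u' : E3} (hu' : u' ∈ hcpKissingPattern) :
    1 / 2 ≤ ‖((Real.sqrt (18 : ℕ))⁻¹ • intVec ![3, 3, 0] : E3) + u'‖ := by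
  have h := bravaisGap_third_le_norm_cap_add_sq hu'
  nlinarith [norm_nonneg (((Real.sqrt (18 : ℕ))⁻¹ • intVec ![3, 3, 0] : E3) + u')]

/-! ## The stretched, scaled pattern points -/

/-- The coordinate sum of a unit vector of `ℝ³` is at most `2` in absolute value
(`(u₀+u₁+u₂)² ≤ 3‖u‖² = 3 < 4`). -/
theorem bravaisGap_abs_sum_le_two {u : E3} (hu : ‖u‖ = 1) : |u 0 + u 1 + u 2| ≤ 2 := by
  have hsq : ‖u‖ ^ 2 = u 0 ^ 2 + u 1 ^ 2 + u 2 ^ 2 := by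
    rw [EuclideanSpace.real_norm_sq_eq, Fin.sum_univ_three]
    try simp only [Real.norm_eq_abs, sq_abs]
  rw [hu, one_pow] at hsq
  have hb : (u 0 + u 1 + u 2) ^ 2 ≤ 3 := by
    nlinarith [sq_nonneg (u 0 - u 1), sq_nonneg (u 1 - u 2), sq_nonneg (u 0 - u 2)]
  rw [abs_le]
  constructor <;> nlinarith [hb, sq_nonneg (u 0 + u 1 + u 2 + 2), sq_nonneg (u 0 + u 1 + u 2 - 2)]

/-- `‖intVec (1,1,1)‖ ≤ 2` (`√3 < 2`). -/
theorem bravaisGap_norm_ones_le_two : ‖intVec ![1, 1, 1]‖ ≤ 2 := by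
  have h : ‖intVec ![1, 1, 1]‖ ^ 2 = 3 := by
    rw [bravaisGap_norm_intVec_sq]; simp [sqNormInt]
  nlinarith [norm_nonneg (intVec ![1, 1, 1])]

/-- The stretch-and-scale map of the target shell: `S(u) = a·(u + (t(u₀+u₁+u₂)/3)·(1,1,1))`. -/
theorem bravaisGap_target_eq (a t : ℝ) : target a t =
    hcpKissingPattern.image fun u : E3 => a • (u + (t * (u 0 + u 1 + u 2) / 3) • intVec ![1, 1, 1]) :=
  rfl

/-- **The stretched cap point plus any stretched pattern point stays away from `0`**: for
`u₀ = (3,3,0)/√18`, `u' ∈ hcpKissingPattern`, `|t| ≤ 1/100` and `a > 0`, `‖S(u₀) + S(u')‖ > 2a/5`,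
`S(u) = a·(u + (t(u₀+u₁+u₂)/3)·(1,1,1))`. -/
theorem bravaisGap_norm_stretch_add_gt {a t : ℝ} (ha : 0 < a) (ht : |t| ≤ 1 / 100) {u u' : E3}
    (hu : u = ((Real.sqrt (18 : ℕ))⁻¹ • intVec ![3, 3, 0] : E3)) (hu' : u' ∈ hcpKissingPattern) :
    2 * a / 5 < ‖a • (u + (t * (u 0 + u 1 + u 2) / 3) • intVec ![1, 1, 1]) +
      a • (u' + (t * (u' 0 + u' 1 + u' 2) / 3) • intVec ![1, 1, 1])‖ := by
  have hu0 : u ∈ hcpKissingPattern := hu ▸ bravaisGap_cap_mem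
  set e : E3 := intVec ![1, 1, 1] with he
  set c : ℝ := t * (u 0 + u 1 + u 2) / 3 + t * (u' 0 + u' 1 + u' 2) / 3 with hc
  have hsum : a • (u + (t * (u 0 + u 1 + u 2) / 3) • e) + a • (u' + (t * (u' 0 + u' 1 + u' 2) / 3) • e) =
      a • ((u + u') + c • e) := by
    rw [← smul_add, hc, add_smul]; congr 1; abel
  rw [hsum, norm_smul, Real.norm_of_nonneg ha.le]
  have h1 : 1 / 2 ≤ ‖u + u'‖ := hu ▸ bravaisGap_half_le_norm_cap_add hu'
  have hs := bravaisGap_abs_sum_le_two (norm_eq_one_of_mem_hcpKissingPattern hu0)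
  have hs' := bravaisGap_abs_sum_le_two (norm_eq_one_of_mem_hcpKissingPattern hu')
  have ht0 : 0 ≤ |t| := abs_nonneg t
  have hcabs : |c| ≤ 1 / 75 := by
    have e1 : |t * (u 0 + u 1 + u 2) / 3| ≤ |t| * 2 / 3 := by
      rw [abs_div, abs_mul, abs_of_pos (by norm_num : (0:ℝ) < 3)]
      gcongr
    have e2 : |t * (u' 0 + u' 1 + u' 2) / 3| ≤ |t| * 2 / 3 := by
      rw [abs_div, abs_mul, abs_of_pos (by norm_num : (0:ℝ) < 3)]
      gcongr
    have := (abs_add_le (t * (u 0 + u 1 + u 2) / 3) (t * (u' 0 + u' 1 + u' 2) / 3)).trans (add_le_add e1 e2)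
    rw [← hc] at this
    linarith
  have hce : ‖c • e‖ ≤ 2 / 75 := by
    rw [norm_smul, Real.norm_eq_abs]
    calc |c| * ‖e‖ ≤ (1 / 75) * 2 :=
          mul_le_mul hcabs bravaisGap_norm_ones_le_two (norm_nonneg _) (by norm_num)
      _ = 2 / 75 := by norm_num
  have hge : ‖u + u'‖ - ‖c • e‖ ≤ ‖u + u' + c • e‖ := by
    have := norm_sub_le_norm_add (u + u' + c • e) (c • e)
    have h' : ‖u + u'‖ ≤ ‖u + u' + c • e‖ + ‖c • e‖ := by
      have := norm_add_le (u + u' + c • e) (-(c • e))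
      rw [norm_neg, add_neg_cancel_right] at this
      exact this
    linarith
  nlinarith [hge, h1, hce]

/-! ## No centrosymmetric set is `(a/5)`-close to `S(a,t)` -/

/-- **Centrosymmetric exclusion.**  If a finite set `T ⊂ ℝ³` is symmetric under `p ↦ −p`, then it is not
`(a/5)`-close to the stretched hcp shell `S(a,t)` (`0 < a`, `|t| ≤ 1/100`), for any linear isometry:
the partner `q₁` of `−p`, where `p` is the partner of a shell point `q₀`, would satisfy
`‖q₀ + q₁‖ ≤ 2a/5`, contradicting `bravaisGap_norm_stretch_add_gt`. -/
theorem bravaisGap_not_shellCloseTo_of_centrosymmetric {a t : ℝ} (ha : 0 < a) (ht : |t| ≤ 1 / 100)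
    {T : Finset E3} (hT : ∀ p ∈ T, -p ∈ T) : ¬ ShellCloseTo (a / 5) T (target a t) := by
  rintro ⟨A, e, he⟩
  -- the image of the stretched cap point
  set S : E3 → E3 := fun u => a • (u + (t * (u 0 + u 1 + u 2) / 3) • intVec ![1, 1, 1]) with hS
  set u₀ : E3 := (Real.sqrt (18 : ℕ))⁻¹ • intVec ![3, 3, 0] with hu₀
  have hq₀ : A (S u₀) ∈ (target a t).image A := by
    rw [bravaisGap_target_eq, Finset.image_image]
    exact Finset.mem_image_of_mem _ bravaisGap_cap_mem
  set p : ↥T := e.symm ⟨A (S u₀), hq₀⟩ with hp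
  have hp₀ : dist (p : E3) (A (S u₀)) ≤ a / 5 := by
    have := he p
    rwa [hp, Equiv.apply_symm_apply] at this
  have hnegp : -(p : E3) ∈ T := hT _ p.2
  have hq₁mem : ((e ⟨-(p : E3), hnegp⟩ : ↥((target a t).image A)) : E3) ∈ (target a t).image A :=
    (e ⟨-(p : E3), hnegp⟩).2
  have hp₁ : dist (-(p : E3)) (e ⟨-(p : E3), hnegp⟩ : E3) ≤ a / 5 := he ⟨-(p : E3), hnegp⟩
  generalize hgen : ((e ⟨-(p : E3), hnegp⟩ : ↥((target a t).image A)) : E3) = q₁ at hq₁mem hp₁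
  rw [bravaisGap_target_eq, Finset.image_image] at hq₁mem
  obtain ⟨u', hu', hq₁⟩ := Finset.mem_image.1 hq₁mem
  -- so ‖A (S u₀) + A (S u')‖ ≤ 2a/5
  have hsmall : ‖A (S u₀) + A (S u')‖ ≤ 2 * a / 5 := by
    have h1 : ‖A (S u₀) - (p : E3)‖ ≤ a / 5 := by rwa [← dist_eq_norm, dist_comm]
    have h2 : ‖-(p : E3) - A (S u')‖ ≤ a / 5 := by
      rw [← dist_eq_norm]
      have : (A ∘ S) u' = A (S u') := rfl
      rw [← this, hq₁]; exact hp₁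
    calc ‖A (S u₀) + A (S u')‖ = ‖(A (S u₀) - p) - (-(p : E3) - A (S u'))‖ := by congr 1; abel
      _ ≤ ‖A (S u₀) - (p : E3)‖ + ‖-(p : E3) - A (S u')‖ := norm_sub_le _ _
      _ ≤ 2 * a / 5 := by linarith
  have hbig := bravaisGap_norm_stretch_add_gt ha ht rfl hu'
  rw [← map_add, LinearIsometry.norm_map] at hsmall
  exact absurd (lt_of_lt_of_le hbig hsmall) (lt_irrefl _)

/-! ## Part 2 · Bravais lattices: points, reflections, translations -/

section Bravais

variable {P : PeriodicConfiguration 3} {y : E3}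

/-- In a Bravais configuration (one-point motif `{y}`) the points are exactly `y + G`. -/
theorem bravaisGap_mem_points_iff (hP : P.motif = {y}) {z : E3} :
    z ∈ P.points ↔ ∃ g ∈ P.lattice, z = y + g := by
  constructor
  · rintro ⟨y', hy', g, hg, rfl⟩
    rw [hP, Finset.mem_singleton] at hy'
    exact ⟨g, hg, by rw [hy']⟩
  · rintro ⟨g, hg, rfl⟩
    exact ⟨y, by rw [hP]; exact Finset.mem_singleton_self y, g, hg, rfl⟩

/-- The centre `y` is a point. -/
theorem bravaisGap_centre_mem (hP : P.motif = {y}) : y ∈ P.points :=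
  (bravaisGap_mem_points_iff hP).2 ⟨0, P.lattice.zero_mem, (add_zero y).symm⟩

/-- Differences of points are lattice vectors. -/
theorem bravaisGap_sub_mem_lattice (hP : P.motif = {y}) {z z' : E3} (hz : z ∈ P.points)
    (hz' : z' ∈ P.points) : z - z' ∈ P.lattice := by
  obtain ⟨g, hg, rfl⟩ := (bravaisGap_mem_points_iff hP).1 hz
  obtain ⟨g', hg', rfl⟩ := (bravaisGap_mem_points_iff hP).1 hz'
  have : y + g - (y + g') = g - g' := by abel
  rw [this]; exact P.lattice.sub_mem hg hg'

/-- Translating a point by a difference of two points gives a point. -/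
theorem bravaisGap_add_sub_mem (hP : P.motif = {y}) {z z₁ z₂ : E3} (hz : z ∈ P.points)
    (h₁ : z₁ ∈ P.points) (h₂ : z₂ ∈ P.points) : z + (z₁ - z₂) ∈ P.points :=
  P.add_mem_points hz (bravaisGap_sub_mem_lattice hP h₁ h₂)

/-- The reflection `2y − z = y + (y − z)` of a point through the centre is a point. -/
theorem bravaisGap_reflect_mem (hP : P.motif = {y}) {z : E3} (hz : z ∈ P.points) :
    y + (y - z) ∈ P.points :=
  bravaisGap_add_sub_mem hP (bravaisGap_centre_mem hP) (bravaisGap_centre_mem hP) hz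

/-- The reflection preserves the distance to the centre. -/
theorem bravaisGap_dist_reflect (y z : E3) : dist (y + (y - z)) y = dist z y := by
  rw [dist_eq_norm, dist_eq_norm, add_sub_cancel_left, norm_sub_rev]

end Bravais

/-! ## Part 3 · The finite ball configuration and the pairing of weights -/

section Pairing

variable {P : PeriodicConfiguration 3} {y : E3} {ρ R : ℝ} {N : ℕ} {x : Fin N → E3} {i₀ : Fin N}
  {σ : Fin N → Fin N}

/-! HYPOTHESES of this section (no bundling structure, to keep the file definition-free): `x` enumerates
injectively the points of the Bravais configuration `P` (motif `{y}`) in the closed ball of radius `ρ`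
about `y = x i₀` (`hmotif`, `hinj`, `hrange`, `hcentre`), and `σ` is the reflection of indices through
the centre (`hσ : x (σ j) = y + (y − x j)`, obtained by `choose` from `bravaisGap_exists_reflect`). -/

/-- Every point of the ball is enumerated. -/
theorem bravaisGap_exists_index (hrange : Set.range x = {z | z ∈ P.points ∧ dist z y ≤ ρ}) {z : E3}
    (hz : z ∈ P.points) (hzρ : dist z y ≤ ρ) : ∃ m, x m = z := by
  have : z ∈ Set.range x := by rw [hrange]; exact ⟨hz, hzρ⟩
  exact this

/-- Enumerated points are points of `P` within `ρ`. -/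
theorem bravaisGap_index_mem (hrange : Set.range x = {z | z ∈ P.points ∧ dist z y ≤ ρ}) (j : Fin N) :
    x j ∈ P.points ∧ dist (x j) y ≤ ρ := by
  have : x j ∈ Set.range x := ⟨j, rfl⟩
  rw [hrange] at this
  exact this

/-- The reflected point of every enumerated point is enumerated. -/
theorem bravaisGap_exists_reflect (hmotif : P.motif = {y})
    (hrange : Set.range x = {z | z ∈ P.points ∧ dist z y ≤ ρ}) (j : Fin N) :
    ∃ j', x j' = y + (y - x j) :=
  bravaisGap_exists_index hrange (bravaisGap_reflect_mem hmotif (bravaisGap_index_mem hrange j).1)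
    (by rw [bravaisGap_dist_reflect]; exact (bravaisGap_index_mem hrange j).2)

/-- The reflection of indices is an involution. -/
theorem bravaisGap_refl_refl (hinj : Function.Injective x) (hσ : ∀ j, x (σ j) = y + (y - x j))
    (j : Fin N) : σ (σ j) = j := by
  apply hinj
  rw [hσ, hσ]
  abel

/-- The reflection preserves the distance to the centre. -/
theorem bravaisGap_dist_refl (hσ : ∀ j, x (σ j) = y + (y - x j)) (j : Fin N) :
    dist (x (σ j)) y = dist (x j) y := by
  rw [hσ, bravaisGap_dist_reflect]

/-- The reflection fixes only the centre. -/
theorem bravaisGap_refl_ne (hinj : Function.Injective x) (hcentre : x i₀ = y)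
    (hσ : ∀ j, x (σ j) = y + (y - x j)) {j : Fin N} (hj : j ≠ i₀) : σ j ≠ i₀ := by
  intro h
  have h1 := hσ j
  rw [h, hcentre] at h1
  have h2 : y - x j = 0 := by
    have := congrArg (fun w => w - y) h1
    simpa using this.symm
  exact hj (hinj ((sub_eq_zero.1 h2).symm.trans hcentre.symm))

/-- **Pattern identity.**  For a bond `(i₀, j)` with `dist (x j) y ≤ ρ − R`, the joint `R`-pattern of
the reflected bond `(i₀, σ j)` is the pattern of `(i₀, j)` recentred by `−(x j − y)`: the ball
configuration is invariant under the lattice translation by `x j − y` on the region the two patterns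
see. -/
theorem bravaisGap_bondPattern_refl (hmotif : P.motif = {y})
    (hrange : Set.range x = {z | z ∈ P.points ∧ dist z y ≤ ρ}) (hcentre : x i₀ = y)
    (hσ : ∀ j, x (σ j) = y + (y - x j)) (j : Fin N) (hj : dist (x j) y ≤ ρ - R) :
    bondPattern R x i₀ (σ j) = (bondPattern R x i₀ j).image (fun u => u - (x j - x i₀)) := by
  have hRρ : R ≤ ρ := by linarith [dist_nonneg (x := x j) (y := y)]
  have hσj := hσ j
  have hmem := bravaisGap_index_mem hrange
  ext u
  simp only [bondPattern, Finset.mem_image, Finset.mem_filter, Finset.mem_univ, true_and, hcentre]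
  constructor
  · rintro ⟨m, hm, rfl⟩
    -- z := x m + (x j - y) is a point in the ball
    have hz : x m + (x j - y) ∈ P.points :=
      bravaisGap_add_sub_mem hmotif (hmem m).1 (hmem j).1 (bravaisGap_centre_mem hmotif)
    have hzρ : dist (x m + (x j - y)) y ≤ ρ := by
      rcases hm with hm | hm
      · calc dist (x m + (x j - y)) y = ‖(x m - y) + (x j - y)‖ := by rw [dist_eq_norm]; congr 1; abel
          _ ≤ ‖x m - y‖ + ‖x j - y‖ := norm_add_le _ _
          _ ≤ R + (ρ - R) := add_le_add (by rwa [← dist_eq_norm]) (by rwa [← dist_eq_norm])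
          _ = ρ := by ring
      · rw [hσj] at hm
        calc dist (x m + (x j - y)) y = dist (x m) (y + (y - x j)) := by
              rw [dist_eq_norm, dist_eq_norm]; congr 1; abel
          _ ≤ R := hm
          _ ≤ ρ := hRρ
    obtain ⟨l, hl⟩ := bravaisGap_exists_index hrange hz hzρ
    refine ⟨x l - y, ⟨l, ?_, rfl⟩, ?_⟩
    · rw [hl]
      rcases hm with hm | hm
      · right
        calc dist (x m + (x j - y)) (x j) = dist (x m) y := by
              rw [dist_eq_norm, dist_eq_norm]; congr 1; abel
          _ ≤ R := hm
      · left
        rw [hσj] at hm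
        calc dist (x m + (x j - y)) y = dist (x m) (y + (y - x j)) := by
              rw [dist_eq_norm, dist_eq_norm]; congr 1; abel
          _ ≤ R := hm
    · rw [hl]; abel
  · rintro ⟨u₀, ⟨l, hl, rfl⟩, rfl⟩
    -- z := x l + (y - x j) is a point in the ball
    have hz : x l + (y - x j) ∈ P.points :=
      bravaisGap_add_sub_mem hmotif (hmem l).1 (bravaisGap_centre_mem hmotif) (hmem j).1
    have hzρ : dist (x l + (y - x j)) y ≤ ρ := by
      rcases hl with hl | hl
      · calc dist (x l + (y - x j)) y = ‖(x l - y) - (x j - y)‖ := by rw [dist_eq_norm]; congr 1; abel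
          _ ≤ ‖x l - y‖ + ‖x j - y‖ := norm_sub_le _ _
          _ ≤ R + (ρ - R) := add_le_add (by rwa [← dist_eq_norm]) (by rwa [← dist_eq_norm])
          _ = ρ := by ring
      · calc dist (x l + (y - x j)) y = dist (x l) (x j) := by
              rw [dist_eq_norm, dist_eq_norm]; congr 1; abel
          _ ≤ R := hl
          _ ≤ ρ := hRρ
    obtain ⟨m, hm⟩ := bravaisGap_exists_index hrange hz hzρ
    refine ⟨m, ?_, ?_⟩
    · rw [hm, hσj]
      rcases hl with hl | hl
      · right
        calc dist (x l + (y - x j)) (y + (y - x j)) = dist (x l) y := by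
              rw [dist_eq_norm, dist_eq_norm]; congr 1; abel
          _ ≤ R := hl
      · left
        calc dist (x l + (y - x j)) y = dist (x l) (x j) := by
              rw [dist_eq_norm, dist_eq_norm]; congr 1; abel
          _ ≤ R := hl
    · rw [hm]; abel

/-- **Weights of a bond and of its reflection sum to one** (complementarity of the rule + the pattern
identity), for every bond `(i₀, j)`, `j ≠ i₀`, with `dist (x j) y ≤ ρ − R`. -/
theorem bravaisGap_weight_add_weight_refl (hmotif : P.motif = {y}) (hinj : Function.Injective x)
    (hrange : Set.range x = {z | z ∈ P.points ∧ dist z y ≤ ρ}) (hcentre : x i₀ = y)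
    (hσ : ∀ j, x (σ j) = y + (y - x j)) {Φ : E3 → Finset E3 → ℝ} (hΦ : IsRule Φ) (j : Fin N)
    (hj : j ≠ i₀) (hjρ : dist (x j) y ≤ ρ - R) :
    Φ (x j - x i₀) (bondPattern R x i₀ j) + Φ (x (σ j) - x i₀) (bondPattern R x i₀ (σ j)) = 1 := by
  have hv : x j - x i₀ ≠ 0 := sub_ne_zero.2 (fun h => hj (hinj h))
  have h := hΦ.2 (x j - x i₀) (bondPattern R x i₀ j) hv
  rw [bravaisGap_bondPattern_refl hmotif hrange hcentre hσ j hjρ]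
  have hneg : x (σ j) - x i₀ = -(x j - x i₀) := by
    rw [hσ, hcentre]; abel
  rw [hneg]
  exact h

end Pairing

/-! ## Registered anchor of this file -/

/-- **Registered anchor `stub_negCentrosymmetricShell`** (binder-free form of
`bravaisGap_not_shellCloseTo_of_centrosymmetric`): no centrosymmetric finite set is `(a/5)`-close to
the stretched hcp shell `S(a,t)`, `0 < a`, `|t| ≤ 1/100`. -/
theorem stub_negCentrosymmetricShell : ∀ a t : ℝ, 0 < a → |t| ≤ 1 / 100 → ∀ T : Finset E3,
    (∀ p ∈ T, -p ∈ T) → ¬ ShellCloseTo (a / 5) T (target a t) :=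
  fun _ _ ha ht _ hT => bravaisGap_not_shellCloseTo_of_centrosymmetric ha ht hT

end Summit.AtomisticToContinuum.Crystallization.Theorems.StrictSplittingRuleBirth

end
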